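/-
Copyright (c) 2026 the pub-hodgecm-mathlib formalisation cell (harness21).  Seat LA7-p01 (g7), dealt BY NAME by the LD chair LD1-plan (g3)
(«ROAD O HANDS v4», 2026-09-02T13:06:19Z), 2026-09-02.  Statement module: ONE named fact (Hodge-free re-type «#184♮» of ★
`Liu2021/CurveHolThetaNonOrthogonal.lean`, which is NOT edited) + ONE one-line specialisation theorem «♮ ⇒ #184».
-/
import Literature.NumberTheory.Automorphic.Liu2021.CurveHolThetaNonOrthogonal
import HarnessLib

/-!
# [Liu2021, Thm. B.4 (1) (a)⇒(c) (p. 98); proof of Prop. D.4 (1) (p. 131 L8–21)] — letter (A₂-P♮), HODGE-FREE: an `L²`-discrete class of the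
# CM unitary CURVE `U(H)` with a θ-TYPE finite component AT THE LABEL `λ` is NOT ORTHOGONAL to the global theta lifts from some hermitian LINE

Topic `NumberTheory/Automorphic/Liu2021`; namespace `Literature.NumberTheory.Automorphic.Liu2021`.  Contents: ONE closed named fact
`def curveTheta_nonOrthogonal₂ : Prop` and ONE theorem `curveHolTheta_nonOrthogonal₂_of_hodgeFree : curveTheta_nonOrthogonal₂ → curveHolTheta_nonOrthogonal₂`.

WHAT AND WHY.  ★ `curveHolTheta_nonOrthogonal₂` (letter (A₂-P), «#184», file `CurveHolThetaNonOrthogonal.lean`, untouched) states Liu's non-orthogonality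
for discrete `P` that are HOLOMORPHIC of Hodge type `(1,0)` at `ι` (binder `P.IsHolCotangentAt₂ … (cmPlace L ι) 𝔣`).  The printed mechanism never reads
that binder: [Liu2021, Thm. B.4 (1)] is stated for «an irreducible admissible representation `π` of `G(𝔸_F)`» with «a cuspidal realization `V_π`» and a
strictly unitary automorphic character `μ` (arXiv text p0045 L7–L22), i.e. it is ARCHIMEDEAN-BLIND, and its pole input (a) for a θ-type finite
component is read off the unramified finite local types alone ([Lem. D.1 (3)]: local base change `λ_v ⊞ λᶜ_v χ̌_v` at almost every `v`, so
`L^S(s, π × λ⁻¹) · L^S(2s, λ⁻¹, As)` = `ζ^S_L(s)` × a partial Hecke `L`-function non-vanishing at `s = 1` × a factor regular at `s = 1` — a pole at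
`s₀ = 1`, whence (c) `Θ^W_{(μ,ν),V}(V_π) ≠ 0` for a skew-hermitian LINE `W` (`n + 1 − 2s₀ = 1`), and the pairing ∕ Fubini round trip on the two compact
quotients gives the typed conclusion — exactly as in #184's module docstring).  This file therefore types the SAME sentence with the two idle binders
removed — the hypothesis `P.IsHolCotangentAt₂ …` AND the cone frame `(𝔣 : ConeFrame L H (cmPlace L ι))`, which entered #184 only through that
hypothesis — and nothing else changed (every other token is #184's, byte for byte, so that twins type identical terms).  The specialisation
`curveHolTheta_nonOrthogonal₂_of_hodgeFree` records «(A₂-P♮) ⇒ (A₂-P)», so every ★ consumer of #184 stands.  Audit trail: LD-ref1 (g3) LETTER AUDIT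
2026-09-02T12:30:11Z note (n1) («the Hodge hypothesis is NOT used by the printed mechanism — Thm. B.4 (1) (a)⇒(b)⇒(c) is archimedean-blind») and
BOX ROAD-O #4 13:05:30Z ((c-i) drop the idle `𝔣` too; (c-ii) the `♮ ⇒ #184` one-liner).  USE: line «ROAD O» of the LD leaves of crux `HLiu418`
(`Lines/F0_P6LD_StubS1FactsThetaRoad.lean`, `Lines/F0_P6LD_StubS1bFactsOrganRoad.lean`) applies the letter to an irreducible closed copy `Q′ ≃ᵤ P`
of a holomorphic `P` found inside the orthogonal complement of a theta span; `Q′` inherits the θ-type finite component along the unitary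
equivalence but is not known to be holomorphic at the function level, so (A₂-P) as typed does not apply to it while (A₂-P♮) does.

PRINT (materialised pages, arXiv:2102.11518 text of record `paper:arxiv-2102.11518`).  p0045 L7–L22 = [Thm. B.4]: «Let `π` be an irreducible admissible
representation of `G(𝔸_F)`, let `V_π` be a cuspidal realization of `π` (Definition B.1), and let `μ : E^×\𝔸_E^× → ℂ^×` be a strictly unitary automorphic
character. (1) For `s₀ ∈ ℂ` with `Re(s₀) > 0`, consider: (a) `L^S(s, π × μ) · L^S(2s, μ, As^{(−1)^n})` has a pole at `s₀` … (c) `Θ^W_{(μ,ν),V}(V_π) ≠ 0` for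
some skew-hermitian space `W` of dimension `n + 1 − 2s₀` and some `ν` with `ν|_{𝔸_F^×} = μ_{E/F}^n` (independent of `ν`). Then (a) ⇒ (b) ⇒ (c).
(2) The skew-hermitian space `W` in (1c) is unique up to isomorphism.»; p0044 L24–L36 = the frame of App. B («`F` totally real, `E/F` totally imaginary
quadratic», `V` hermitian of rank `n`, `W` skew-hermitian of rank `m`, the global theta lifting `Θ^W_{(μ,ν),V}`); p0058 L44 – p0059 L3 = [Prop. D.4 (1)
and its proof]: «… there exists a conjugate symplectic automorphic character `μ` of weight one such that `L(s, Π ⊗ μ)` has a simple pole at `s = 1`.  By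
Theorem B.4, we have a skew-hermitian space `W` over `E` of rank 1 … and an automorphic character `χ′` of `U(W)(𝔸_F)`, such that `π` is realized in the
space of global theta lifting `Θ^V_{ψ_F,(μ,ν),W}(χ′)`.»  Journal pagination of the anchors (p. 98; p. 131 L8–21) is #184's, verbatim.

HONEST SCOPE.  (o) Same AMF-free reading as #184 (Path Y): what the letter ASSERTS needs only the pole of the PARTIAL `L`-function attached to the
unramified local types of `σ` and [Thm. B.4 (1)] (a) ⇒ (c) (doubling ∕ Siegel–Weil, [Liu2021, §B.3]; unitary version of [GinzburgJiangSoudry2009,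
Thm. 1.1]); [Rogawski1990, §11] and [Harris1993] enter Liu's paragraph only for the existence ∕ multiplicity half of Prop. D.4 (1), which this letter
does NOT assert — context citations, kept because the anchors are #184's verbatim.  (i) DEEP, no carrier in the tree (no automorphic `L`-functions of
`U(2) × GL₁`, no Siegel–Weil): recorded as the printed road, exactly like #184.  (ii) Junk profile: `P` ranges over ALL `L²`-discrete irreducible
closed subrepresentations with the θ-type finite component `σ ↪ ω(λ, ε_a, χ)_f`; B.4 (1) covers every such `P` (the quotient `[U(H)]` is compact since
`H` is definite at a real place other than `ι`, which exists as `4 ≤ [L:ℚ]`, so «discrete» = «cuspidal»); a one-dimensional `P` (automorphic character)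
has no θ-type finite component (its unramified parameters are `η_v q_v^{±1/2}`, not the unitary `λ_v ⊞ λᶜ_v χ̌_v`), so no vacuous instance arises from
characters; `μW`, `f`, `Φ` occur only in `∃`-positions of the conclusion (harmless, as in #184).  Without the θ-type finite component the sentence is
false in general (only `∃ μ` would hold) — that binder is KEPT.  (iii) CORRECTED w.r.t. #184's scope note (ii) «without `IsHolCotangentAt₂` false»:
that remark is withdrawn by the critic's audit (n1) — the hypothesis is idle in print; this file is the record of that correction, #184 itself is
not edited (append-only tree).  (iv) Domain NARROWER than print (d ≥ 2 ⇒ compact Shimura curve; print allows `F = ℚ`) — safe direction (LD-ref1 (n3)).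
(v) Books: if line ROAD O builds, the LD printed rows {#184, #185} become {#184♮} (same anchors); until then this file moves no digit.
HC_CM is proved only modulo the 7 printed citations (2 remaining: hLiu418 = stmt-HodgeConjecture-24832, h413 = stmt-HodgeConjecture-24833) until
rung 0 closes; count-neutral.

## References
* [Liu2021] Y. Liu, Camb. J. Math. 9 (2021) = arXiv:2102.11518: App. B Thm. B.4 (1) (p. 98; arXiv text p0045 L7–L22), Def. B.1–B.2 (p0044 L13–L36);
  App. D, Prop. D.4 (1) and its proof (p. 130 L34 – p. 131 L21; arXiv text p0058 L44 – p0059 L3); Lem. D.1 (3).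
* [GinzburgJiangSoudry2009] D. Ginzburg, D. Jiang, D. Soudry, J. Inst. Math. Jussieu 8 (2009), Thm. 1.1 (B.4 is «the unitary version of a weaker
  form», p0045 L5).
* [JacquetShalika1981] H. Jacquet, J. Shalika, Amer. J. Math. 103 (1981), Thm. 4.4.
* [Rogawski1990] J. Rogawski, Ann. of Math. Stud. 123 (1990), §11, Thm. 11.5.1 (context only).
* [Harris1993] M. Harris, J. AMS 6 (1993), Thm. 2.6.3 (context only).
-/

noncomputable section

open NumberField NumberField.InfinitePlace MeasureTheory IsDedekindDomain
open scoped Matrix ComplexOrder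

namespace Literature.NumberTheory.Automorphic.Liu2021

open _root_.MeasureTheory
open Literature.NumberTheory.Automorphic Literature.NumberTheory.Automorphic.UnitaryGroup
open Literature.NumberTheory.Automorphic.UnitaryGroup.CotangentForms
open Literature.NumberTheory.Automorphic.UnitaryCurveForms
open Literature.NumberTheory.Automorphic.IdeleClassGroup
open Literature.NumberTheory.Automorphic.Liu2021.Def411WeilCarriers
open Literature.NumberTheory.Automorphic.Liu2021.Def411WeilCarriersDoubling
open Literature.NumberTheory.GaloisRepresentations
open Literature.NumberTheory.GelbartRogawski1991 Literature.NumberTheory.GelbartRogawski1991.UnitaryDualPair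
open Literature.NumberTheory.Weil1964
open Literature.RepresentationTheory.Liu2021 Literature.RepresentationTheory.HarrisKudlaSweet1996

/-- **Letter (A₂-P♮) [Liu2021, proof of Prop. D.4 (1) p. 131 L8–21 via Thm. B.4 (1) (a)⇒(c) p. 98], HODGE-FREE** — «an `L²`-discrete class of `U(H)`
with θ-type finite component `σ ↪ ω(λ, ε_a, χ)_f` is NOT ORTHOGONAL to the global theta lifts from some hermitian LINE `⟨a′⟩` at the `λ`-splitting»:
in the curve letters' frame (CM field `L` with `4 ≤ [L:ℚ]`, `ι`, `H` congruent to `diag dV` of signature `(1,1)` at `ι` and definite at every other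
complex place, label `λ` conjugate symplectic of weight one, line `a`, `χ ∈ Chi`, irreducible smooth `σ` with an injective intertwiner
`j : σ → ω(λ, ε_a, χ)_f ∘ (finAdelicCongr … g ht hg)⁻¹`), for the pinned adelic transport `ιA`, EVERY discrete `P` with finite component `σ` admits a line
`a′`, a Weil-majorant witness, a finite invariant measure on `[U(⟨a′⟩)]`, a continuous weight `f`, a Schwartz–Bruhat `Φ` and a square-integrability
witness such that the orthogonal projection to `P` of the theta class `[x ↦ Θ̃_Φ(f)(ιA x)]` is NON-ZERO.  This is ★ `curveHolTheta_nonOrthogonal₂` (#184)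
with the hypothesis `P.IsHolCotangentAt₂ … 𝔣` and the then-idle cone-frame binder `𝔣` removed and every other token unchanged.  Hodge-free: B.4 (1) is
stated for an arbitrary irreducible admissible `π` with a cuspidal realisation `V_π` (arXiv text p0045 L7–L20), archimedean-blind, and the pole (a) at
`s₀ = 1`, `μ = λ` (Liu's normalisation, footnote l. 2136) comes from the unramified θ-types of `σ` alone ([Lem. D.1 (3)]; Hecke ∕ Tate pole, edge
non-vanishing [JacquetShalika1981, Thm. 4.4]); LD-ref1 LETTER AUDIT (n1), BOX ROAD-O #4 (c-i)(c-ii).  AMF-free reading as in #184: [Rogawski1990, §11]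
and [Harris1993] serve only the existence ∕ multiplicity half of Prop. D.4 (1), not asserted here.
[cite: Liu2021, App. D proof of Prop. D.4 (1) (p. 131 L8–21); App. B Thm. B.4 (1) (p. 98); proof of Prop. 4.13 Case 1 (l. 2129–2137); Lem. D.1 (3)]
[cite: JacquetShalika1981, Thm. 4.4] [cite: GinzburgJiangSoudry2009, Thm. 1.1] [cite: Rogawski1990, §11 Thm. 11.5.1] [cite: Harris1993, Thm. 2.6.3] -/
def curveTheta_nonOrthogonal₂ : Prop :=
  ∀ (L : Type) [Field L] [NumberField L] [IsCMField L] (ι : L →+* ℂ) (H : Matrix (Fin 2) (Fin 2) L)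
    (dV : Fin 2 → L) (hdV : ∀ i, IsCMField.complexConj L (dV i) = dV i) (hdV0 : ∀ i, dV i ≠ 0)
    (t : L) (ht : t ≠ 0) (g : GL (Fin 2) L)
    (hg : formCongr ((IsCMField.complexConj L : L ≃ₐ[↥(maximalRealSubfield L)] L) : L →+* L) g (t • H) = Matrix.diagonal dV),
    (∃ T : GL (Fin 2) ℂ, formCongr (starRingEnd ℂ) T ((Matrix.diagonal dV).map ι) = Matrix.diagonal ![(1 : ℂ), -1]) →
    (∀ τ' : L →+* ℂ, InfinitePlace.mk τ' ≠ InfinitePlace.mk ι → ((Matrix.diagonal dV).map τ').PosDef) →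
    4 ≤ Module.finrank ℚ L →
    ∀ (μ : Measure (adelicGroupData (↥(maximalRealSubfield L)) L (IsCMField.complexConj L) 2 H).automorphicQuotient)
      [(adelicGroupData (↥(maximalRealSubfield L)) L (IsCMField.complexConj L) 2 H).IsAutomorphicMeasure μ]
      {n' : ℕ} (e₁ : Fin 2 × Fin 1 ≃ Fin n')
      (lam : Literature.NumberTheory.Automorphic.IdeleClassGroup L →ₜ* Circle) (hlam : IsConjugateSymplectic L lam), HasWeight L lam 1 →
    ∀ (a : (↥(maximalRealSubfield L))ˣ) (χ : Chi (↥(maximalRealSubfield L)) L (IsCMField.complexConj L))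
      (W : Type) [AddCommGroup W] [Module ℂ W]
      (σ : Representation ℂ (finAdelic (↥(maximalRealSubfield L)) L (IsCMField.complexConj L) 2 H) W),
      σ.IsIrreducible → σ.IsSmooth →
    ∀ j : σ.IntertwiningMap
        ((rhoVAtLine (↥(maximalRealSubfield L)) L (IsCMField.complexConj L) 2 e₁ (Matrix.diagonal dV)
            (complexConj_imagUnit L) (imagUnit_ne_zero L) (imagUnit_mul_self L) (realDiagonal_isSymm L dV hdV)
            (isUnit_det_realDiagonal L dV hdV hdV0) (realDiagonal_map L dV hdV).symm
            (fun a => isCompatible_chiSplittingLine L e₁ dV hdV hdV0 (toHeckeCharacter L lam)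
              (isUnitary_toHeckeCharacter L lam) ((isOscillatorChar_toHeckeCharacter_iff lam).mpr hlam)
              (TW (↥(maximalRealSubfield L)) a) (isSymm_TW (↥(maximalRealSubfield L)) a)
              (isUnit_det_TW (↥(maximalRealSubfield L)) a) (JW (↥(maximalRealSubfield L)) L a)
              (JW_eq (↥(maximalRealSubfield L)) L a)) a χ).comp
          (finAdelicCongr (↥(maximalRealSubfield L)) L (IsCMField.complexConj L) g ht hg).symm.toMonoidHom),
      Function.Injective j →
    ∀ (ιA : (adelicGroupData (↥(maximalRealSubfield L)) L (IsCMField.complexConj L) 2 H).Adelic →*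
        ↥(UnitaryGroup.adelic (↥(maximalRealSubfield L)) L (IsCMField.complexConj L) 2 (Matrix.diagonal dV))),
      (∀ k, ((ιA k : ↥(UnitaryGroup.adelic (↥(maximalRealSubfield L)) L (IsCMField.complexConj L) 2 (Matrix.diagonal dV))) :
            GL (Fin 2) (AdeleRing (𝓞 L) L)) =
          (toAdeleGL L g)⁻¹ * adelicVal (↥(maximalRealSubfield L)) L (IsCMField.complexConj L) 2 H k * toAdeleGL L g) →
    ∀ [CompactSpace (↥(UnitaryGroup.adelic (↥(maximalRealSubfield L)) L (IsCMField.complexConj L) 2 (Matrix.diagonal dV)) ⧸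
        (UnitaryGroup.toAdelic (↥(maximalRealSubfield L)) L (IsCMField.complexConj L) 2 (Matrix.diagonal dV)).range)]
      [CompactSpace (adelicGroupData (↥(maximalRealSubfield L)) L (IsCMField.complexConj L) 2 H).automorphicQuotient],
    ∀ P : DiscreteAutomorphicRep (adelicGroupData (↥(maximalRealSubfield L)) L (IsCMField.complexConj L) 2 H) μ,
      P.HasFinComponent σ →
      ∃ a' : (↥(maximalRealSubfield L))ˣ,
        letI : MeasurableSpace (↥(UnitaryGroup.adelic (↥(maximalRealSubfield L)) L (IsCMField.complexConj L) 1 (JW (↥(maximalRealSubfield L)) L a')) ⧸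
            (UnitaryGroup.toAdelic (↥(maximalRealSubfield L)) L (IsCMField.complexConj L) 1 (JW (↥(maximalRealSubfield L)) L a')).range) := borel _
        haveI := normal_range_toAdelic_JW L a'
        ∃ (hρ : HasThetaMajorants fun
            (p : ↥(UnitaryGroup.adelic (↥(maximalRealSubfield L)) L (IsCMField.complexConj L) 2 (Matrix.diagonal dV)) ×
              ↥(UnitaryGroup.adelic (↥(maximalRealSubfield L)) L (IsCMField.complexConj L) 1 (JW (↥(maximalRealSubfield L)) L a')))
              (Φ : piSchwartzBruhat (↥(maximalRealSubfield L)) (Fin n')) =>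
              pairRep (↥(maximalRealSubfield L)) L (IsCMField.complexConj L) 2 1 e₁ (Matrix.diagonal dV) (JW (↥(maximalRealSubfield L)) L a')
                (chiSplittingLine L e₁ dV hdV hdV0 (toHeckeCharacter L lam) (isUnitary_toHeckeCharacter L lam)
                  ((isOscillatorChar_toHeckeCharacter_iff lam).mpr hlam) (TW (↥(maximalRealSubfield L)) a')
                  (isUnit_det_TW (↥(maximalRealSubfield L)) a') (JW (↥(maximalRealSubfield L)) L a') (JW_eq (↥(maximalRealSubfield L)) L a'))
                p Φ)
          (μW : Measure (↥(UnitaryGroup.adelic (↥(maximalRealSubfield L)) L (IsCMField.complexConj L) 1 (JW (↥(maximalRealSubfield L)) L a')) ⧸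
            (UnitaryGroup.toAdelic (↥(maximalRealSubfield L)) L (IsCMField.complexConj L) 1 (JW (↥(maximalRealSubfield L)) L a')).range))
          (_ : IsFiniteMeasure μW)
          (_ : SMulInvariantMeasure ↥(UnitaryGroup.adelic (↥(maximalRealSubfield L)) L (IsCMField.complexConj L) 1 (JW (↥(maximalRealSubfield L)) L a'))
            (↥(UnitaryGroup.adelic (↥(maximalRealSubfield L)) L (IsCMField.complexConj L) 1 (JW (↥(maximalRealSubfield L)) L a')) ⧸
              (UnitaryGroup.toAdelic (↥(maximalRealSubfield L)) L (IsCMField.complexConj L) 1 (JW (↥(maximalRealSubfield L)) L a')).range) μW)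
          (f : C((↥(UnitaryGroup.adelic (↥(maximalRealSubfield L)) L (IsCMField.complexConj L) 1 (JW (↥(maximalRealSubfield L)) L a')) ⧸
            (UnitaryGroup.toAdelic (↥(maximalRealSubfield L)) L (IsCMField.complexConj L) 1 (JW (↥(maximalRealSubfield L)) L a')).range), ℂ))
          (Φ : piSchwartzBruhat (↥(maximalRealSubfield L)) (Fin n'))
          (hθ : MemLp (toQuotFun (adelicGroupData (↥(maximalRealSubfield L)) L (IsCMField.complexConj L) 2 H) fun x =>
            (lineThetaKernelDatum L 2 e₁ dV hdV hdV0 lam hlam a' hρ).thetaLiftFun μW Φ f (ιA x)) 2 μ),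
          P.space.toSubmodule.starProjection (MemLp.toLp _ hθ) ≠ 0

/-- **(A₂-P♮) ⇒ (A₂-P)**: the Hodge-free letter `curveTheta_nonOrthogonal₂` implies the holomorphic letter ★ `curveHolTheta_nonOrthogonal₂` (#184) — the
latter is the former's specialisation to discrete `P` with `P.IsHolCotangentAt₂ … 𝔣`; the cone frame `𝔣` and the Hodge hypothesis are simply discarded.
Hence every consumer of #184 stands once (A₂-P♮) is the cited row (LD-ref1 BOX ROAD-O #4 (c-ii)).  Both sides formalise the same printed sentence.
[cite: Liu2021, App. D proof of Prop. D.4 (1) (p. 131 L8–21); App. B Thm. B.4 (1) (p. 98)] -/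
theorem curveHolTheta_nonOrthogonal₂_of_hodgeFree (h : curveTheta_nonOrthogonal₂) : curveHolTheta_nonOrthogonal₂ := by
  intro L _ _ _ ι H dV hdV hdV0 t ht g hg hT hpos h4 _𝔣 μ _ n' e₁ lam hlam hw a χ W _ _ σ hirr hsm j hj ιA hιA _ _ P _hhol hfin
  exact h L ι H dV hdV hdV0 t ht g hg hT hpos h4 μ e₁ lam hlam hw a χ W σ hirr hsm j hj ιA hιA P hfin

end Literature.NumberTheory.Automorphic.Liu2021

end
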